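import Literature.AlgebraicGeometry.Frobenioids.ArchimedeanFSMIChainsN0
import Literature.AlgebraicGeometry.Frobenioids.ArchimedeanArcs
import HarnessLib

/-!
# Frobenioids II, Proposition 3.4 (viii) for `F₀ = A₀`: FSMI-morphisms lower the potential;
# condition (b) of "FSMFF-type" (2008 and 2024 forms) for the angular Frobenioid `A₀`

Mochizuki, *The geometry of Frobenioids II: poly-Frobenioids*, Kyushu J. Math. **62** (2008)
401–460, §3, proof of Proposition 3.4 (viii), p. 32 ll. 5–30 [cite: MochizukiFrdII2008, Prop 3.4 (viii) p.32];
Remark 3.3.1 p. 29; [FrdI] *Comments* (Jan 2024) (28): the revised condition (b) of "FSMFF-type".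

PROOF-ONLY file (abc-iut cell, layer L1, sub-DAG `SUBDAG-FrdII-Prop34.md` rows **P34-L10** /
**P34-L11** for `F₀ = A₀`, seat abc-iut-w5-d092; consumed BY NAME by row P34-L13, abc-iut-w5-d152).
The angular Frobenioid `A₀ ⊆ C₀` (Ex. 3.3 (iii), abc-iut-L1-t6's `ArchFrd.A0`: the isometries) has
NON-LINEAR arrows, so two cases beyond `ArchimedeanFSMIChainsN0.lean` occur:

* real objects, `deg_Fr ≥ 2`: "the existence of torsion elements in `O^×(C)` of arbitrary order … implies
  [since `φ` is a monomorphism] that … `φ` is linear" (p. 32 ll. 9–12) — `A0.degFr_eq_one_of_mono_of_isRealObj`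
  via the rotations `C0.rotHom` of the complex isotropic object over `A`;
* complex objects, `deg_Fr ≥ 2`: a monomorphism is injective on the angular region (Remark 3.3.1, here for
  the absolute `A₀`: `A0.injOn_regionMap_of_mono`, by the narrow test objects of abc-iut-L1-t6's
  `C.exists_testPair`), so the potential drops by "angular regions never shrink" + Lemma 3.2 (v)
  (`C0.fsmiRank_lt_of_injOn`) — the integer `N` "bounding the number of non-linear FSMI factors".

Results: `A0.isIso_of_isFSM_of_isRealObj`, `A0.not_isFSMI_of_isComplex_of_isReal`,
`A0.isComplexObj_of_isFSMI`, **`A0.fsmiRank_lt_of_isFSMI`**, `A0.isFSMIChain_le`,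
`A0.bounded_isFSMIChain` (2008 (b)), **`A0.bounded_headedFSMIChain`** (2024 (b), bound `C0.fsmiRank + 1`).
HONEST SCOPE: only condition (b); [FrdII] §3 is classical and undisputed.
-/

namespace Literature.AlgebraicGeometry.Frobenioids

open Set Function Topology Real CategoryTheory
open scoped Pointwise

noncomputable section

namespace ArchFrd

/-! ### Remark 3.3.1 at the level of `C₀`: narrow test pairs -/

namespace C0

/-- **Remark 3.3.1, test pair in `C₀`**: if `a ↦ c · a^d` identifies two points `a₁ ≠ a₂` of `A_X`
(`X` complex), a narrow object `W` carries two DIFFERENT linear isometries `(id, 1, 1), (id, 1, a₂/a₁)`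
into `X` equalised by `φ` (abc-iut-L1-t6's `C.exists_testPair`, without the `D`-components).
[cite: MochizukiFrdII2008, Rmk 3.3.1 p.29] -/
theorem exists_testPair₀ {X Y : C0} (φ : X ⟶ Y) (hX : X.IsComplexObj) {a₁ a₂ : ℂˣ}
    (ha₁ : a₁ ∈ X.region.carrier) (ha₂ : a₂ ∈ X.region.carrier)
    (heq : regionMap φ a₁ = regionMap φ a₂) (hne : a₁ ≠ a₂) :
    ∃ (W : C0) (g h : W ⟶ X), g ≠ h ∧ g ≫ φ = h ≫ φ ∧
      PreFrobenioid.IsIsometry toElem g ∧ PreFrobenioid.IsIsometry toElem h ∧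
      degFr g = 1 ∧ degFr h = 1 := by
  -- adapted from abc-iut-L1-t6's `C.exists_testPair` (ArchimedeanMonoInjective.lean)
  have hd : a₁ ^ (degFr φ : ℕ) = a₂ ^ (degFr φ : ℕ) := mul_left_cancel heq
  have hnorm : ‖(a₁ : ℂ)‖ = ‖(a₂ : ℂ)‖ := by
    have h := congrArg (fun u : ℂˣ => ‖(u : ℂ)‖) hd
    simp only [Units.val_pow_eq_pow_val, norm_pow] at h
    exact (pow_left_inj₀ (norm_nonneg _) (norm_nonneg _) (degFr φ).ne_zero).mp h
  set ζ : ℂˣ := a₂ * a₁⁻¹ with hζ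
  have hζd : ζ ^ (degFr φ : ℕ) = 1 := by rw [hζ, mul_pow, inv_pow, ← hd, mul_inv_cancel]
  have hζ1 : ‖(ζ : ℂ)‖ = 1 := by
    rw [hζ, Units.val_mul, Units.val_inv_eq_inv_val, norm_mul, norm_inv, ← hnorm,
      mul_inv_cancel₀ (norm_ne_zero_iff.mpr a₁.ne_zero)]
  have hζn : ζ ∈ normOneSubgroup ℂ := by rw [mem_normOneSubgroup_iff]; exact hζ1
  set ζu : normOneSubgroup ℂ := ⟨ζ, hζn⟩ with hζu
  have ha₂ζ : a₂ = ζ * a₁ := by rw [hζ, inv_mul_cancel_right]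
  set w₁ := unitPart ℂ a₁ with hw₁
  have hw₂ : unitPart ℂ a₂ = ζu * w₁ := by
    rw [ha₂ζ, unitPart_mul, hw₁]; congr 1; exact unitPart_coe_normOne ζu
  obtain ⟨ε₁, hε₁, hε₁π, h₁⟩ := exists_arcDir_subset X.region.isOpen_dir ha₁.1
  obtain ⟨ε₂, hε₂, -, h₂⟩ := exists_arcDir_subset X.region.isOpen_dir ha₂.1
  have hε : 0 < min ε₁ ε₂ := lt_min hε₁ hε₂
  have hεπ : min ε₁ ε₂ < Real.pi := lt_of_le_of_lt (min_le_left _ _) hε₁π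
  let W : C0 := ⟨X.base, arcRegion w₁ (min ε₁ ε₂) hε hεπ X.region.tip,
    fun h => D0.noConfusion (h.symm.trans hX)⟩
  have hmemX : ∀ u : ℂˣ, u ∈ W.region.carrier → unitPart ℂ u ∈ X.region.dir →
      u ∈ X.region.carrier := fun u hu h1 => ⟨h1, hu.2⟩
  let g : W ⟶ X :=
    { base := 𝟙 _, degFr := 1, scalar := 1, scalar_mem := one_mem _,
      mapsTo := by
        rw [one_smul, PNat.one_coe, pow_one]
        change W.region.carrier ⊆ pullRegion X (𝟙 X.base)
        rw [pullRegion_id]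
        intro u hu
        exact hmemX u hu (h₁ (arcDir_mono w₁ (min_le_left _ _) hu.1)) }
  have hζs : ζ ∈ D0.scalars X.base := by
    rw [show X.base = D0.complex from hX]; exact Subgroup.mem_top _
  let h : W ⟶ X :=
    { base := 𝟙 _, degFr := 1, scalar := ζ, scalar_mem := hζs,
      mapsTo := by
        rw [PNat.one_coe, pow_one]
        change ζ • W.region.carrier ⊆ pullRegion X (𝟙 X.base)
        rw [pullRegion_id]
        rintro _ ⟨u, hu, rfl⟩
        refine ⟨?_, ?_⟩
        · have hdir : unitPart ℂ (ζ • u) = ζu * unitPart ℂ u := by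
            rw [smul_eq_mul, unitPart_mul, unitPart_coe_normOne ζu]
          rw [hdir]
          apply h₂
          rw [hw₂]
          exact (mem_arcDir_mul_iff ζu w₁ _ _).mpr (arcDir_mono w₁ (min_le_right _ _) hu.1)
        · have hn : absHom ℂ (ζ • u) = absHom ℂ u := by
            apply Subtype.ext
            rw [coe_absHom, coe_absHom, smul_eq_mul, Units.val_mul, norm_mul, hζ1, one_mul]
          rw [hn]
          exact hu.2 }
  refine ⟨W, g, h, ?_, ?_, ?_, ?_, rfl, rfl⟩
  · intro hgh
    have hs : (1 : ℂˣ) = ζ := congrArg scalar hgh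
    exact hne (by rw [ha₂ζ, ← hs, one_mul])
  · refine hom_ext rfl rfl ?_
    change (Base g).act (scalar φ) * (1 : ℂˣ) ^ (degFr φ : ℕ) = (Base h).act (scalar φ) * ζ ^ (degFr φ : ℕ)
    rw [one_pow, hζd]
  · refine (A0.isIsometry_iff_norm_mul_tip_pow g).mpr ?_
    change ‖((1 : ℂˣ) : ℂ)‖ * (X.tip : ℝ) ^ ((1 : ℕ+) : ℕ) = X.tip
    rw [Units.val_one, norm_one, one_mul, PNat.one_coe, pow_one]
  · refine (A0.isIsometry_iff_norm_mul_tip_pow h).mpr ?_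
    change ‖(ζ : ℂ)‖ * (X.tip : ℝ) ^ ((1 : ℕ+) : ℕ) = X.tip
    rw [hζ1, one_mul, PNat.one_coe, pow_one]

end C0

namespace A0

variable {P Q : A0}

/-- An arrow of `A₀` is an isomorphism iff its underlying `C₀`-arrow is (the inverse is an isometry).
[cite: MochizukiFrdII2008, Ex 3.3 (iii) p.28] -/
theorem isIso_iff_isIso_hom (φ : P ⟶ Q) : IsIso φ ↔ IsIso φ.hom := by
  constructor
  · intro h; exact (inferInstance : IsIso (ι.map φ))
  · intro h
    refine ⟨⟨⟨inv φ.hom, C0.isIsometry_inv φ.hom⟩, ?_, ?_⟩⟩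
    · exact WideSubcategory.hom_ext _ (IsIso.hom_inv_id φ.hom)
    · exact WideSubcategory.hom_ext _ (IsIso.inv_hom_id φ.hom)

/-- **Remark 3.3.1 for the absolute `A₀`**: a monomorphism out of a complex object is injective on the
angular region. [cite: MochizukiFrdII2008, Rmk 3.3.1 p.29] -/
theorem injOn_regionMap_of_mono (φ : P ⟶ Q) [hm : Mono φ] (hP : P.obj.IsComplexObj) :
    InjOn (C0.regionMap φ.hom) P.obj.region.carrier := by
  intro a₁ ha₁ a₂ ha₂ heq
  by_contra hne
  obtain ⟨W, g, h, hgh, hcomp, hg, hh, -, -⟩ := C0.exists_testPair₀ φ.hom hP ha₁ ha₂ heq hne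
  let W' : A0 := ⟨W⟩
  let g' : W' ⟶ P := ⟨g, hg⟩
  let h' : W' ⟶ P := ⟨h, hh⟩
  have : g' ≫ φ = h' ≫ φ := WideSubcategory.hom_ext _ hcomp
  exact hgh (congrArg InducedWideCategory.Hom.hom (hm.right_cancellation g' h' this))

/-! ### Real objects -/

/-- **A monomorphism of `A₀` out of a REAL object is linear** ("the existence of torsion elements in
`O^×(C)` of arbitrary order … implies … that `φ` is linear", p. 32 ll. 9–12): otherwise a nontrivial
rotation of the complex isotropic object `C` over `P` by a `deg_Fr`-th root of unity is equalised by
`C → P → Q`. [cite: MochizukiFrdII2008, Prop 3.4 (viii) p.32] -/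
theorem degFr_eq_one_of_mono_of_isRealObj (φ : P ⟶ Q) [hm : Mono φ] (hP : P.obj.IsRealObj) :
    C0.degFr φ.hom = 1 := by
  by_contra hd
  have hd2 : 2 ≤ (C0.degFr φ.hom : ℕ) := by
    rcases (Nat.succ_le_of_lt (C0.degFr φ.hom).pos : 1 ≤ (C0.degFr φ.hom : ℕ)).eq_or_lt with h | h
    · exact absurd (PNat.coe_inj.mp ((h.symm).trans PNat.one_coe.symm)) hd
    · exact h
  obtain ⟨ζ, hζ, hζd, hζ1⟩ := C0.exists_rootOfUnity hd2
  obtain ⟨-, -, hψi⟩ := C0.toRealOf_data (P := P.obj) hP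
  have hρi : PreFrobenioid.IsIsometry C0.toElem
      (C0.rotHom (C0.complexIsotropic P.obj.region.tip) rfl rfl ζ hζ) := by
    rw [A0.isIsometry_iff_norm_mul_tip_pow]
    change ‖(ζ : ℂ)‖ * ((C0.complexIsotropic P.obj.region.tip).tip : ℝ) ^ ((1 : ℕ+) : ℕ) = _
    rw [hζ, one_mul, PNat.one_coe, pow_one]
  let C : A0 := ⟨C0.complexIsotropic P.obj.region.tip⟩
  let ψ : C ⟶ P := ⟨C0.toRealOf P.obj hP, hψi⟩
  let ρ : C ⟶ C := ⟨C0.rotHom (C0.complexIsotropic P.obj.region.tip) rfl rfl ζ hζ, hρi⟩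
  have hcomp : (ρ ≫ ψ) ≫ φ = ψ ≫ φ := by
    rw [Category.assoc]
    refine WideSubcategory.hom_ext _ ?_
    change C0.rotHom (C0.complexIsotropic P.obj.region.tip) rfl rfl ζ hζ ≫
      (C0.toRealOf P.obj hP ≫ φ.hom) = C0.toRealOf P.obj hP ≫ φ.hom
    refine C0.rotHom_comp (X := C0.complexIsotropic P.obj.region.tip) rfl rfl hζ _ ?_
    rw [C0.degFr_comp', (C0.toRealOf_data hP).1, one_mul]
    exact hζd
  have := hm.right_cancellation _ _ hcomp
  exact C0.rotHom_comp_toRealOf_ne hP hζ hζ1 (congrArg InducedWideCategory.Hom.hom this)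

/-- **An FSM-morphism of `A₀` between real objects is an isomorphism** (p. 32 ll. 7–13).
[cite: MochizukiFrdII2008, Prop 3.4 (viii) p.32] -/
theorem isIso_of_isFSM_of_isRealObj (φ : P ⟶ Q) (hφ : IsFSM φ) (hP : P.obj.IsRealObj)
    (hQ : Q.obj.IsRealObj) : IsIso φ := by
  haveI := hφ.2
  haveI := C0.isIso_of_isRealObj_of_degFr_eq_one φ.hom hP hQ
    (degFr_eq_one_of_mono_of_isRealObj φ hP) φ.property
  exact (isIso_iff_isIso_hom φ).2 inferInstance

/-! ### No FSMI-morphism from a complex object to a real object -/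

/-- **No FSMI-morphism of `A₀` goes from a complex object to a real object.**
[cite: MochizukiFrdII2008, Prop 3.4 (viii) p.32] -/
theorem not_isFSMI_of_isComplex_of_isReal (φ : P ⟶ Q) (hP : P.obj.IsComplexObj)
    (hQ : Q.obj.IsRealObj) : ¬ IsFSMI φ := by
  rintro ⟨⟨-, hmono⟩, hnot, hirr⟩
  by_cases hPi : P.obj.region.IsIsotropic
  · -- isotropic source: an automorphism equalised by `φ`
    rcases (Nat.succ_le_of_lt (C0.degFr φ.hom).pos : 1 ≤ (C0.degFr φ.hom : ℕ)).eq_or_lt with hd1 | hd2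
    · -- linear: the conjugation
      have hd1' : C0.degFr φ.hom = 1 := PNat.coe_inj.mp (hd1.symm.trans PNat.one_coe.symm)
      obtain ⟨s, hs, hsd⟩ := C0.exists_conj_ratio (C0.scalar φ.hom)
      have hρiso : PreFrobenioid.IsIsometry C0.toElem (C0.conjHom P.obj hP hPi s hs) := by
        rw [A0.isIsometry_iff_norm_mul_tip_pow]
        change ‖(s : ℂ)‖ * P.obj.tip ^ ((1 : ℕ+) : ℕ) = P.obj.tip
        rw [hs, one_mul, PNat.one_coe, pow_one]
      let ρ : P ⟶ P := ⟨C0.conjHom P.obj hP hPi s hs, hρiso⟩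
      have hρφ : ρ ≫ φ = 𝟙 P ≫ φ := by
        rw [Category.id_comp]
        refine WideSubcategory.hom_ext _ ?_
        refine C0.conjHom_comp hP hPi hs φ.hom hQ ?_
        rw [hd1']; exact hsd
      have hρ : ρ = 𝟙 P := hmono.right_cancellation _ _ hρφ
      exact C0.conjHom_ne_id hP hPi hs (congrArg InducedWideCategory.Hom.hom hρ)
    · -- non-linear: a rotation by a root of unity
      obtain ⟨ζ, hζ, hζd, hζ1⟩ := C0.exists_rootOfUnity (Nat.succ_le_of_lt hd2)
      have hρiso : PreFrobenioid.IsIsometry C0.toElem (C0.rotHom P.obj hP hPi ζ hζ) := by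
        rw [A0.isIsometry_iff_norm_mul_tip_pow]
        change ‖(ζ : ℂ)‖ * P.obj.tip ^ ((1 : ℕ+) : ℕ) = P.obj.tip
        rw [hζ, one_mul, PNat.one_coe, pow_one]
      let ρ : P ⟶ P := ⟨C0.rotHom P.obj hP hPi ζ hζ, hρiso⟩
      have hρφ : ρ ≫ φ = 𝟙 P ≫ φ := by
        rw [Category.id_comp]
        refine WideSubcategory.hom_ext _ ?_
        exact C0.rotHom_comp hP hPi hζ φ.hom hζd
      have hρ : ρ = 𝟙 P := hmono.right_cancellation _ _ hρφ
      exact C0.rotHom_ne_id hP hPi hζ hζ1 (congrArg InducedWideCategory.Hom.hom hρ)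
  · -- non-isotropic source: factor through the isotropic hull
    have htiso : PreFrobenioid.IsIsometry C0.toElem (C0.toIsotropic P.obj) :=
      (A0.isIsometry_iff_ratio_eq_one _).2 (C0.ratio_toIsotropic _)
    have hliso : PreFrobenioid.IsIsometry C0.toElem (C0.liftIsotropify φ.hom hQ) := by
      rw [A0.isIsometry_iff_norm_mul_tip_pow]
      exact (A0.isIsometry_iff_norm_mul_tip_pow φ.hom).1 φ.property
    let M : A0 := ⟨C0.isotropify P.obj⟩
    let t : P ⟶ M := ⟨C0.toIsotropic P.obj, htiso⟩
    let l : M ⟶ Q := ⟨C0.liftIsotropify φ.hom hQ, hliso⟩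
    have hfac : t ≫ l = φ := WideSubcategory.hom_ext _ (C0.toIsotropic_comp_liftIsotropify _ hQ)
    rcases hirr t l hfac with hl | ht
    · haveI : IsIso l.hom := (isIso_iff_isIso_hom l).1 hl
      exact C0.not_isIso_of_complex_real l.hom hP hQ inferInstance
    · haveI : IsIso t.hom := (isIso_iff_isIso_hom t).1 ht
      exact C0.not_isIso_toIsotropic P.obj hPi (by change IsIso t.hom; infer_instance)

/-- **Every FSMI-morphism of `A₀` has complex domain and codomain** (p. 32 ll. 13–14).
[cite: MochizukiFrdII2008, Prop 3.4 (viii) p.32] -/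
theorem isComplexObj_of_isFSMI (φ : P ⟶ Q) (hφ : IsFSMI φ) :
    P.obj.IsComplexObj ∧ Q.obj.IsComplexObj := by
  rcases D0.isReal_or_isComplex P.obj.base with hP | hP
  · exact absurd (isIso_of_isFSM_of_isRealObj φ hφ.1 hP (C0.isRealObj_of_hom φ.hom hP)) hφ.2.1
  rcases D0.isReal_or_isComplex Q.obj.base with hQ | hQ
  · exact absurd hφ (not_isFSMI_of_isComplex_of_isReal φ hP hQ)
  exact ⟨hP, hQ⟩

/-! ### The potential drops along FSMI-morphisms -/

/-- **The FSMI-potential drops along every FSMI-morphism of `A₀`**: non-linear ones are injective on the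
angular region (Remark 3.3.1) and at least double the angular length; linear ones are slit morphisms
(Lemma 3.2 (ix)). [cite: MochizukiFrdII2008, Prop 3.4 (viii) p.32] -/
theorem fsmiRank_lt_of_isFSMI (φ : P ⟶ Q) (hφ : IsFSMI φ) :
    Q.obj.fsmiRank < P.obj.fsmiRank := by
  obtain ⟨hP, hQ⟩ := isComplexObj_of_isFSMI φ hφ
  obtain ⟨⟨hfs, hmono⟩, hnot, -⟩ := hφ
  rcases (Nat.succ_le_of_lt (C0.degFr φ.hom).pos : 1 ≤ (C0.degFr φ.hom : ℕ)).eq_or_lt with hd1 | hd2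
  · -- linear: the slit case
    have hd1' : C0.degFr φ.hom = 1 := PNat.coe_inj.mp (hd1.symm.trans PNat.one_coe.symm)
    have hnotc : ¬ IsIso φ.hom := fun h => hnot ((isIso_iff_isIso_hom φ).2 h)
    haveI : IsIso (C0.Base φ.hom) := D0.isIso_of_isComplex _ hP hQ
    have hPi : ¬ P.obj.region.IsIsotropic := fun hPi =>
      hnotc (C0.isIso_of_isIsotropic φ.hom hPi hd1'
        ((A0.isIsometry_iff_norm_mul_tip_pow _).1 φ.property))
    have hQi : Q.obj.region.IsIsotropic := by
      refine C0.isIsotropic_of_linear_lifts φ.hom hP hQ hd1' φ.property hnotc ?_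
      intro D hD hDo hDQ
      let Z : A0 := ⟨C0.subObj Q.obj hQ D hD hDo⟩
      obtain ⟨-, -, -, hi⟩ := C0.subHom_data Q.obj hQ hD hDo hDQ
      let γ : Z ⟶ Q := ⟨C0.subHom Q.obj hQ hD hDo hDQ, hi⟩
      obtain ⟨W, δP, δZ, hsq⟩ := hfs γ
      exact ⟨W.obj, δP.hom, δZ.hom, congrArg InducedWideCategory.Hom.hom hsq⟩
    exact C0.fsmiRank_lt_of_isIsotropic hP hPi (Or.inr hQi)
  · -- non-linear: injective on the region, the angular length at least doubles
    haveI := hmono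
    exact C0.fsmiRank_lt_of_injOn φ.hom hP hQ (Nat.succ_le_of_lt hd2)
      (injOn_regionMap_of_mono φ hP)

/-- The potential never increases along an arrow of `A₀`. [cite: MochizukiFrdII2008, Prop 3.4 (viii) p.32] -/
theorem fsmiRank_le_of_hom (φ : P ⟶ Q) : Q.obj.fsmiRank ≤ P.obj.fsmiRank :=
  C0.fsmiRank_le_of_hom φ.hom

/-! ### Condition (b) of "FSMFF-type" for `A₀` -/

/-- A chain of `n` FSMI-morphisms out of `A` has `n ≤ C0.fsmiRank A`. [cite: MochizukiFrdII2008, Prop 3.4 (viii) p.32] -/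
theorem isFSMIChain_le {A B : A0} {φ : A ⟶ B} {n : ℕ} (h : IsFSMIChain φ n) :
    n ≤ A.obj.fsmiRank := by
  induction h with
  | single φ hφ => exact Nat.one_le_of_lt (fsmiRank_lt_of_isFSMI φ hφ)
  | cons ψ χ n hψ _ ih => exact Nat.succ_le_of_lt (lt_of_le_of_lt ih (fsmiRank_lt_of_isFSMI ψ hψ))

/-- **Condition (b) of "FSMFF-type" (printed 2008 form) for `A₀`.** [cite: MochizukiFrdII2008, Prop 3.4 (viii) p.32] -/
theorem bounded_isFSMIChain (A : A0) :
    ∃ N : ℕ, ∀ {B : A0} (φ : A ⟶ B) (n : ℕ), IsFSMIChain φ n → n ≤ N :=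
  ⟨A.obj.fsmiRank, fun _ _ h => isFSMIChain_le h⟩

/-- **Condition (b) of "FSMFF-type" (author's 2024 form: arbitrary head, FSMI tail) for `A₀`**, with
the bound `C0.fsmiRank A + 1` = print's "`N + 1`" (p. 32 ll. 20–30: at most `N` non-linear FSMI
factors, at most one slit). [cite: MochizukiFrdII2008, Prop 3.4 (viii) p.32] -/
theorem bounded_headedFSMIChain (A : A0) :
    ∃ N : ℕ, ∀ {B : A0} (φ : A ⟶ B) (n : ℕ), IsHeadedFSMIChain ⊤ φ n → n ≤ N := by
  refine ⟨A.obj.fsmiRank + 1, fun φ n h => ?_⟩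
  cases h with
  | single φ _ => exact Nat.succ_le_succ (Nat.zero_le _)
  | comp φ₁ χ m _ hχ =>
    exact Nat.succ_le_succ ((isFSMIChain_le hχ).trans (fsmiRank_le_of_hom φ₁))

end A0

end ArchFrd

end

end Literature.AlgebraicGeometry.Frobenioids
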